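import Mathlib
import Summits.ValiantsHypothesis.ValiantsHypothesis.Theorems.RigidityForcesSymmetryRankRigidMinimalReprLaplaceFiveSeparatedCaptureCommonLinePairBlock

/-!
# ValiantsHypothesis / RigidityForcesSymmetry — crux `LaplaceOptimalFive` (stmt-ValiantsHypothesis-24813), symmetric capture:
# ★★★ **`CaptureIneqSym` FOR THREE PLANES THROUGH A PAIR-MONOMIAL LINE `u = x_i x_j`** — the last common-line case

Brick 3 (part 11b) of the K1 lane (val-port-2 g6, 2026-08-29).  For symmetric `a, b, c` with `a ∉ ⟨u,b⟩`, `a ∉ ⟨u,c⟩`: two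
block-supported generators ⇒ ✓ `finrank_le_three_of_two_block_spans` (≤ 3, in the labeling given by ✓ `contractZ_mem_L3_swap23/13`);
otherwise an off-block third generator has no diagonal-free prolongation (✓ (P1) `diagFree_prolong_eq_zero_of_offBlock`) and the
complementary pair has prolongation ≤ 3 (else ✓ (P2) `block_of_four_le_finrank_prolong` would give two blocks), so
✓ `finrank_le_three_add_prolong_of_diagFree_eq_zero` gives `3 + 3`.
With ✓ `captureIneqSym_of_common_line_diag` (a diagonal entry) and ✓ `captureIneqSym_of_common_line_three_rows` (zero diagonal, ≥ 3
nonzero rows) this makes `CaptureIneqSym` a theorem for EVERY triple of symmetric 2-planes `⟨u,a⟩, ⟨u,b⟩, ⟨u,c⟩` through a common line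
(`a ∉ ⟨u,b⟩`, `a ∉ ⟨u,c⟩`): a nonzero symmetric `u` has a diagonal entry, or is zero-diagonal with ≥ 3 nonzero rows, or is a pair monomial.

* ★★★ `finrank_le_six_of_common_line_pair`, ★★★ `captureIneqSym_of_common_line_pair`.

Honest framing.  Profiles with a span of finrank ≥ 3 outside the landed cells, `CaptureIneqSym` in general, K1 on `K₃ ⊔ K₂`,
`LaplaceOptimalFive` (OPEN · CONTESTED 72/120), `RankRigidMinimalRepr` and `VP ≠ VNP` are NOT proved here.  No definitions, no `sorry`.
-/

set_option linter.dupNamespace false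
set_option autoImplicit false

namespace Summit.ValiantsHypothesis.ValiantsHypothesis.Theorems.RigidityForcesSymmetryRankRigidMinimalRepr

namespace LaplaceFiveSeparatedCapture

open Finset

/-- ★★★ **`CaptureIneqSym` FOR THREE 2-PLANES THROUGH A PAIR-MONOMIAL LINE: `finrank W ≤ 6`.**  `u` symmetric with `u_{pq} ≠ 0`
exactly for `{p,q} = {i,j}` (`i ≠ j`, `u_{ij} ≠ 0`); `a, b, c` symmetric with `a ∉ ⟨u,b⟩`, `a ∉ ⟨u,c⟩`.  Then every `W` of symmetric
zero-diagonal leaf matrices captured by `L3 ⟨u,a⟩ ⟨u,b⟩ ⟨u,c⟩` has `finrank W ≤ 6`. [folklore] -/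
theorem finrank_le_six_of_common_line_pair (u a b c : Fin 5 → Fin 5 → ℂ) (hu : ∀ p q, u p q = u q p)
    (ha : ∀ p q, a p q = a q p) (hb : ∀ p q, b p q = b q p) (hc : ∀ p q, c p q = c q p)
    (i j : Fin 5) (hij : i ≠ j) (huij : u i j ≠ 0) (hoff : ∀ p q : Fin 5, u p q ≠ 0 → (p = i ∧ q = j) ∨ (p = j ∧ q = i))
    (hab : a ∉ Submodule.span ℂ ({u, b} : Set (Fin 5 → Fin 5 → ℂ))) (hac : a ∉ Submodule.span ℂ ({u, c} : Set (Fin 5 → Fin 5 → ℂ)))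
    (W : Submodule ℂ (Fin 5 → Fin 5 → ℂ))
    (hWs : ∀ μ ∈ W, ∀ s t : Fin 5, μ s t = μ t s) (hWd : ∀ μ ∈ W, ∀ s : Fin 5, μ s s = 0)
    (hWc : ∀ μ ∈ W, contractZ μ ∈ L3 (Submodule.span ℂ ({u, a} : Set (Fin 5 → Fin 5 → ℂ)))
      (Submodule.span ℂ ({u, b} : Set (Fin 5 → Fin 5 → ℂ))) (Submodule.span ℂ ({u, c} : Set (Fin 5 → Fin 5 → ℂ)))) :
    Module.finrank ℂ W ≤ 6 := by
  classical
  have hu0 : u ≠ 0 := fun h => huij (by rw [h]; rfl)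
  have hud : ∀ q, u q q = 0 := fun q => by
    by_contra h
    rcases hoff q q h with ⟨h1, h2⟩ | ⟨h1, h2⟩
    · exact hij (h1.symm.trans h2)
    · exact hij (h2.symm.trans h1)
  have hrow : ∀ q r, q ≠ i → q ≠ j → u q r = 0 := fun q r hqi hqj => by
    by_contra h
    rcases hoff q r h with ⟨h1, -⟩ | ⟨h1, -⟩
    · exact hqi h1
    · exact hqj h1
  have hcol : ∀ q r, r ≠ i → r ≠ j → u q r = 0 := fun q r hri hrj => by rw [hu q r]; exact hrow r q hri hrj
  have hsym2 : ∀ v : Fin 5 → Fin 5 → ℂ, (∀ p q, v p q = v q p) →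
      ∀ x ∈ Submodule.span ℂ ({u, v} : Set (Fin 5 → Fin 5 → ℂ)), ∀ p q : Fin 5, x p q = x q p := by
    intro v hv x hx p q
    obtain ⟨c1, c2, rfl⟩ := Submodule.mem_span_pair.mp hx
    simp only [Pi.add_apply, Pi.smul_apply, smul_eq_mul, hu p q, hv p q]
  have humem : ∀ v : Fin 5 → Fin 5 → ℂ, u ∈ Submodule.span ℂ ({u, v} : Set (Fin 5 → Fin 5 → ℂ)) :=
    fun v => Submodule.subset_span (by simp)
  -- block-supported generators give block-supported planes
  have hblockspan : ∀ v : Fin 5 → Fin 5 → ℂ, (∀ q r : Fin 5, q ≠ i → q ≠ j → v q r = 0) →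
      ∀ x ∈ Submodule.span ℂ ({u, v} : Set (Fin 5 → Fin 5 → ℂ)), ∀ p q : Fin 5, p ≠ i → p ≠ j → x p q = 0 := by
    intro v hv x hx p q hpi hpj
    obtain ⟨c1, c2, rfl⟩ := Submodule.mem_span_pair.mp hx
    simp only [Pi.add_apply, Pi.smul_apply, smul_eq_mul, hrow p q hpi hpj, hv p q hpi hpj, mul_zero, add_zero]
  -- the two-block leaf, in a labeling-free form
  have htbp : ∀ x y z : Fin 5 → Fin 5 → ℂ, (∀ q r : Fin 5, q ≠ i → q ≠ j → x q r = 0) →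
      (∀ q r : Fin 5, q ≠ i → q ≠ j → y q r = 0) →
      (∀ μ ∈ W, contractZ μ ∈ L3 (Submodule.span ℂ ({u, x} : Set (Fin 5 → Fin 5 → ℂ)))
        (Submodule.span ℂ ({u, y} : Set (Fin 5 → Fin 5 → ℂ))) (Submodule.span ℂ ({u, z} : Set (Fin 5 → Fin 5 → ℂ)))) →
      Module.finrank ℂ W ≤ 6 := by
    intro x y z hx hy hWc'
    refine (finrank_le_three_of_two_block_spans i j hij z _ _ _ W (hblockspan x hx) (hblockspan y hy)
      (fun w hw => offBlock_multiple_of_mem_span_pair i j u z (fun p q hp hq => hrow p q hp hq)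
        (fun p q hp hq => hcol p q hp hq) w hw) hWs hWd hWc').trans (by norm_num)
  -- the count `3 + 3 + 0` when the third generator is off-block and the pair is not binary
  have hcount : ∀ y z : Fin 5 → Fin 5 → ℂ, (∀ p q, y p q = y q p) → (∀ p q, z p q = z q p) →
      a ∉ Submodule.span ℂ ({u, y} : Set (Fin 5 → Fin 5 → ℂ)) →
      (∃ q r : Fin 5, q ≠ i ∧ q ≠ j ∧ z q r ≠ 0) →
      Module.finrank ℂ (prolong (Submodule.span ℂ ({u, a} : Set (Fin 5 → Fin 5 → ℂ)) ⊔
        Submodule.span ℂ ({u, y} : Set (Fin 5 → Fin 5 → ℂ)))) ≤ 3 →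
      (∀ μ ∈ W, contractZ μ ∈ L3 (Submodule.span ℂ ({u, a} : Set (Fin 5 → Fin 5 → ℂ)))
        (Submodule.span ℂ ({u, y} : Set (Fin 5 → Fin 5 → ℂ))) (Submodule.span ℂ ({u, z} : Set (Fin 5 → Fin 5 → ℂ)))) →
      Module.finrank ℂ W ≤ 6 := by
    intro y z hy hz hay hnb hp3 hWc'
    have h0 : ∀ G ∈ prolong (Submodule.span ℂ ({u, z} : Set (Fin 5 → Fin 5 → ℂ))), (∀ p : Fin 5, G p p p = 0) → G = 0 :=
      fun G hG hdf => diagFree_prolong_eq_zero_of_offBlock u z hu hz i j hij huij hoff hnb G hG hdf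
    have h := finrank_le_three_add_prolong_of_diagFree_eq_zero u a hu ha hu0 hud _ _ W (hsym2 y hy) (hsym2 z hz)
      (humem y) (humem z) hay h0 hWs hWd hWc'
    omega
  -- case analysis on which generators are block-supported
  by_cases hAB : (∀ q r : Fin 5, q ≠ i → q ≠ j → a q r = 0) ∧ (∀ q r : Fin 5, q ≠ i → q ≠ j → b q r = 0)
  · exact htbp a b c hAB.1 hAB.2 hWc
  by_cases hAC : (∀ q r : Fin 5, q ≠ i → q ≠ j → a q r = 0) ∧ (∀ q r : Fin 5, q ≠ i → q ≠ j → c q r = 0)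
  · exact htbp a c b hAC.1 hAC.2 (fun μ hμ => contractZ_mem_L3_swap23 _ _ _ (hsym2 a ha) μ (hWc μ hμ))
  by_cases hBC : (∀ q r : Fin 5, q ≠ i → q ≠ j → b q r = 0) ∧ (∀ q r : Fin 5, q ≠ i → q ≠ j → c q r = 0)
  · exact htbp c b a hBC.2 hBC.1
      (fun μ hμ => contractZ_mem_L3_swap13 _ _ _ (hsym2 a ha) (hsym2 b hb) (hsym2 c hc) μ (hWc μ hμ))
  -- at most one block generator among `b, c`: pick an off-block one as the third plane
  rcases not_and_or.mp hBC with hb' | hc'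
  · -- `b` off-block: pivot `(a; c, b)`
    have hnb : ∃ q r : Fin 5, q ≠ i ∧ q ≠ j ∧ b q r ≠ 0 := by
      by_contra h
      push Not at h
      exact hb' fun q r hqi hqj => h q r hqi hqj
    have hp3 : Module.finrank ℂ (prolong (Submodule.span ℂ ({u, a} : Set (Fin 5 → Fin 5 → ℂ)) ⊔
        Submodule.span ℂ ({u, c} : Set (Fin 5 → Fin 5 → ℂ)))) ≤ 3 := by
      by_contra h4
      push Not at h4
      exact hAC (block_of_four_le_finrank_prolong u a c hu ha hc i j hij huij hoff (by omega))
    exact hcount c b hc hb hac hnb hp3 (fun μ hμ => contractZ_mem_L3_swap23 _ _ _ (hsym2 a ha) μ (hWc μ hμ))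
  · -- `c` off-block: pivot `(a; b, c)`
    have hnb : ∃ q r : Fin 5, q ≠ i ∧ q ≠ j ∧ c q r ≠ 0 := by
      by_contra h
      push Not at h
      exact hc' fun q r hqi hqj => h q r hqi hqj
    have hp3 : Module.finrank ℂ (prolong (Submodule.span ℂ ({u, a} : Set (Fin 5 → Fin 5 → ℂ)) ⊔
        Submodule.span ℂ ({u, b} : Set (Fin 5 → Fin 5 → ℂ)))) ≤ 3 := by
      by_contra h4
      push Not at h4
      exact hAB (block_of_four_le_finrank_prolong u a b hu ha hb i j hij huij hoff (by omega))
    exact hcount b c hb hc hab hnb hp3 hWc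

/-- ★★★ **`CaptureIneqSym` for three 2-planes through a pair-monomial line** (`6 ≤ Σ finrank`). [folklore] -/
theorem captureIneqSym_of_common_line_pair (u a b c : Fin 5 → Fin 5 → ℂ) (hu : ∀ p q, u p q = u q p)
    (ha : ∀ p q, a p q = a q p) (hb : ∀ p q, b p q = b q p) (hc : ∀ p q, c p q = c q p)
    (i j : Fin 5) (hij : i ≠ j) (huij : u i j ≠ 0) (hoff : ∀ p q : Fin 5, u p q ≠ 0 → (p = i ∧ q = j) ∨ (p = j ∧ q = i))
    (hab : a ∉ Submodule.span ℂ ({u, b} : Set (Fin 5 → Fin 5 → ℂ))) (hac : a ∉ Submodule.span ℂ ({u, c} : Set (Fin 5 → Fin 5 → ℂ)))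
    (W : Submodule ℂ (Fin 5 → Fin 5 → ℂ))
    (h6 : 6 ≤ Module.finrank ℂ (Submodule.span ℂ ({u, a} : Set (Fin 5 → Fin 5 → ℂ)))
      + Module.finrank ℂ (Submodule.span ℂ ({u, b} : Set (Fin 5 → Fin 5 → ℂ)))
      + Module.finrank ℂ (Submodule.span ℂ ({u, c} : Set (Fin 5 → Fin 5 → ℂ))))
    (hWs : ∀ μ ∈ W, ∀ s t : Fin 5, μ s t = μ t s) (hWd : ∀ μ ∈ W, ∀ s : Fin 5, μ s s = 0)
    (hWc : ∀ μ ∈ W, contractZ μ ∈ L3 (Submodule.span ℂ ({u, a} : Set (Fin 5 → Fin 5 → ℂ)))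
      (Submodule.span ℂ ({u, b} : Set (Fin 5 → Fin 5 → ℂ))) (Submodule.span ℂ ({u, c} : Set (Fin 5 → Fin 5 → ℂ)))) :
    Module.finrank ℂ W ≤ Module.finrank ℂ (Submodule.span ℂ ({u, a} : Set (Fin 5 → Fin 5 → ℂ)))
      + Module.finrank ℂ (Submodule.span ℂ ({u, b} : Set (Fin 5 → Fin 5 → ℂ)))
      + Module.finrank ℂ (Submodule.span ℂ ({u, c} : Set (Fin 5 → Fin 5 → ℂ))) :=
  (finrank_le_six_of_common_line_pair u a b c hu ha hb hc i j hij huij hoff hab hac W hWs hWd hWc).trans h6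

end LaplaceFiveSeparatedCapture

end Summit.ValiantsHypothesis.ValiantsHypothesis.Theorems.RigidityForcesSymmetryRankRigidMinimalRepr
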